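import Summits.ABC.IUTFork.Conditional.AbcOfSGenuineMLinUniformBand
import Summits.ABC.IUTFork.Conditional.AbcOfSGenuineKLinUniformRows5
import HarnessLib

/-!
# M LINE: R-W table rows (block F3) DECIDED on the refuted side, UNIFORMLY IN `l`, by [LIN]-uniform BAND theorems — part 5 (M twins of `…LinUniformBandRows5`)
# (triples: 13 ^ 10 * 37 ^ 2 + 3 ^ 7 * 19 ^ 5 * 71 ^ 4 * 223 = 2 ^ 26 * 5 ^ 12 * 1873, 17 ^ 4 + 2 * 7 ^ 12 * 29 ^ 3 * 743 = 3 ^ 9 * 5 ^ 6 * 13 ^ 5 * 23 * 191, 2 ^ 5 * 67 ^ 8 * 107 * 22381 + 5 ^ 4 * 53 ^ 6 * 353 ^ 5 = 3 ^ 22 * 7 ^ 14 * 43 * 83, 3 ^ 22 * 9787 ^ 2 + 5 ^ 10 * 11 * 29 ^ 10 * 109 = 2 ^ 37 * 89 ^ 3 * 167 ^ 2 * 1823)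

PROOF-ONLY file (no `def`, no new `Prop`, no instance) of the abc-iut cell (D-0079 R-W numerics crew seat abc-iut-W-num-6, gen 2; row «W:F3-LINU-BANDS»).
TAKES NO SIDE on [IUTchIII] Cor. 3.12 or on any author. ONE THEOREM PER KNOWN abc TRIPLE, M LINE: this seat's band certificate form
`GenuineM.not_pilotKummerCompatHull_triple_of_linUniform_cert` (`AbcOfSGenuineMLinUniformBand`) of abc-iut-w5-d107's M-line e-free [LIN]-uniform decider p466242 is
instantiated with ONE deciding prime `p ∉ {2,3,5}` of the triple and a short chain of bands `B` (case split on `l ≤ ⌊(p^B(p−1)−1)/30⌋`); every integer side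
condition is a closed numeral checked by `norm_num`, the band membership by `omega`. Each theorem `…_frey<a>_p<p>_band {l} (hl : l.Prime) (hlo : L₀ ≤ l) (hhi : l ≤ L₁) [(hneP : l ≠ p)] (T) (u : FinitePlace ℚ) (hu : ratChar u = p)`
decides, for EVERY prime `l` in its range (not only the tabulated `l ≤ 397` of the R-W numerics lead's WINDOW-TABLE block F3 / TE30-CENSUS) and EVERY genuine
Θ-volume datum `T` over `(ratPoint (a/c), l)`, that the hull-level clause S_H at the summand-route M-level sharp setting of `T`'s OWN read-off ideles (pinned reading — the per-datum object of the M window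
binder of `abc_of_SH_v11M_window`) FAILS for every choice of the free context binders and Kummer datum. The `IsABCTriple` facts are the tree's (abc-iut-w5-d107 / W-ref lineages), BY NAME.
Machine list of the (triple, l) rows: HOME/abc-iut-W-num-6/bands/BAND-ROWS-M.tsv (K list BAND-ROWS.tsv). NOT claimed: admissibility / Szpiro-badness / (P6) of `(ratPoint (a/c), l)`,
non-emptiness of the datum type. HONEST SCOPE as in the parents: SHARP reading; per-label licence STRONGER than print; «refuted as typed» ≠ «refuted in print»;
nothing about the number-level Corollary; typed ≠ proved; instantiated ≠ endorsed. [cite: Mochizuki2012, IUTchIII Cor. 3.12 Step (xi-f) p. 184; IUTchIV Prop. 1.2 p. 10,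
Cor. 2.2 (ii) proof p. 44] [cite: MochizukiGenEll2010, Thm. 2.1 p. 11] [claim: Mochizuki2012, status: disputed] for every IUT sentence quoted.
-/

noncomputable section

open Set Function NumberField IsDedekindDomain

namespace Summit.ABC.IUTFork.Conditional

open Thm311 Thm311.Real Cor312 Cor312Vol Cor312Prov Literature.IUT.LogThetaLattice Literature.IUT.LogVolume
  Literature.IUT.HodgeTheaters Literature.IUT.LogVolume.ThetaData Literature.IUT.LogVolume.Cor22
open Literature.NumberTheory.NumberFields Literature.NumberTheory.GaloisRepresentations.Ultrametric
open Literature.NumberTheory.DiophantineGeometry Literature.NumberTheory.DiophantineGeometry.GenEll Summit.ABC.ABC.Theorems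

/-- **M LINE — R-W ROWS `pilotDataOfK:frey-188728275341281-30687043271724658719-30687232000000000000:l` for EVERY prime `9 ≤ l ≤ 878` with `l ≠ 13` —
REFUTED side at the M setting, unconditionally, BY ONE BAND THEOREM** (M twin of `GenuineK.not_pilotKummerCompatHull_chosen_frey188728275341281_band`;
deciding place `u` over `p = 13`) (block F3 of the R-W numerics lead's WINDOW-TABLE: 72 tabulated Szpiro-bad admissible `l` of this triple, `17 ≤ l ≤
397`): triple `13 ^ 10 * 37 ^ 2 + 3 ^ 7 * 19 ^ 5 * 71 ^ 4 * 223 = 2 ^ 26 * 5 ^ 12 * 1873`; deciding prime `p = 13` (`13^10 ∣ abc`, `p ∤ 30`), bands `B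
= 2` for `l ≤ 67` (certificate `l₀ = 9`); `B = 3` for `l ≤ 878` (certificate `l₀ = 19`); `l = 13` excluded (`p = l` is outside the decider): at the
label `j = l⋆ = (l−1)/2` the [LIN]-uniform test of p464182 holds throughout the band (quadratic certificate `LinUniformBand.test_of_cert`), so the
hull-level clause S_H FAILS at the summand-route M-level sharp setting of the OWN read-off ideles (pinned reading) of every genuine Θ-volume datum
over `(ratPoint (a/c), l)` for every choice of the free context binders and Kummer datum. NOT claimed: admissibility / Szpiro-badness / (P6) /
non-emptiness. [cite: Mochizuki2012, IUTchIII Cor. 3.12 Step (xi-f) p. 184; IUTchIV Prop. 1.2 p. 10] [claim: Mochizuki2012, status: disputed] -/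
theorem GenuineM.not_pilotKummerCompatHull_frey188728275341281_p13_band {l : ℕ} (hl : l.Prime) (hlo : 9 ≤ l) (hhi : l ≤ 878) (hneP : l ≠ 13)
    (T : Cor22.ThetaVolumeDatumAt (ratPoint (((13 ^ 10 * 37 ^ 2 : ℕ) : ℚ) / (2 ^ 26 * 5 ^ 12 * 1873 : ℕ))) l) (u : FinitePlace ℚ) (hu : ratChar u = 13) :
    letI := T.instFieldF; letI := T.instNumberFieldF; letI := T.instAlgebraF; letI := T.instFieldK
    letI := T.instNumberFieldK; letI := T.instAlgebraK; letI := T.instFieldFbar; letI := T.instAlgebraFbar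
    letI := T.instAlgebraKFbar; letI := T.instIsElliptic
    ∀ (M : Type) [Field M] [NumberField M]
      (archPk : ∀ (j : (thetaIndexOfInitial T.D).Label) (vQ : (thetaIndexOfInitial T.D).VQ),
        Set ((logShellsOfInitialDH T.D (analyticLogvVal T.K)).Packet j vQ))
      (archSub : ∀ (j : (thetaIndexOfInitial T.D).Label) (v : (thetaIndexOfInitial T.D).V),
        Set ((logShellsOfInitialDH T.D (analyticLogvVal T.K)).Packet j ((thetaIndexOfInitial T.D).over v)))
      (Ψ : ℤ → ∀ v : (thetaIndexOfInitial T.D).V, v ∈ (thetaIndexOfInitial T.D).Vbad →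
        Set ((logShellsOfInitialDH T.D (analyticLogvVal T.K)).StarPacket v))
      (act : ℤ → ∀ v : (thetaIndexOfInitial T.D).V, v ∈ (thetaIndexOfInitial T.D).Vbad →
        (logShellsOfInitialDH T.D (analyticLogvVal T.K)).StarPacket v →
          Module.End ℚ ((logShellsOfInitialDH T.D (analyticLogvVal T.K)).StarPacket v))
      (Mmod : ℤ → ∀ j : (thetaIndexOfInitial T.D).LabelStar, Set ((logShellsOfInitialDH T.D (analyticLogvVal T.K)).GlobalPacket j.1))
      (region : ℤ → ∀ j : (thetaIndexOfInitial T.D).LabelStar, FinDivisor M → ∀ vQ : (thetaIndexOfInitial T.D).VQ,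
        Set ((logShellsOfInitialDH T.D (analyticLogvVal T.K)).Packet j.1 vQ))
      (frobAdm : ℤ → ℤ → ∀ (j : (thetaIndexOfInitial T.D).Label) (vQ : (thetaIndexOfInitial T.D).VQ),
        Set ((logShellsOfInitialDH T.D (analyticLogvVal T.K)).Packet j vQ) → Prop)
      (frobLogvol : ℤ → ℤ → ∀ (j : (thetaIndexOfInitial T.D).Label) (vQ : (thetaIndexOfInitial T.D).VQ),
        Set ((logShellsOfInitialDH T.D (analyticLogvVal T.K)).Packet j vQ) → ℝ)
      (frobΨ : ℤ → ℤ → ∀ v : (thetaIndexOfInitial T.D).V, v ∈ (thetaIndexOfInitial T.D).Vbad →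
        Set ((logShellsOfInitialDH T.D (analyticLogvVal T.K)).StarPacket v))
      (frobMmod : ℤ → ℤ → ∀ j : (thetaIndexOfInitial T.D).LabelStar, Set ((logShellsOfInitialDH T.D (analyticLogvVal T.K)).GlobalPacket j.1))
      (unitImage : ℤ → ℤ → ℕ → ∀ (j : (thetaIndexOfInitial T.D).Label) (vQ : (thetaIndexOfInitial T.D).VQ),
        Set ((logShellsOfInitialDH T.D (analyticLogvVal T.K)).Packet j vQ))
      (ballImage : ℤ → ℤ → ∀ (j : (thetaIndexOfInitial T.D).Label) (vQ : (thetaIndexOfInitial T.D).VQ),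
        Set ((logShellsOfInitialDH T.D (analyticLogvVal T.K)).Packet j vQ))
      (thetaDiv : ℤ → ℤ → LgpDivisor M (thetaIndexOfInitial T.D).lstar)
      (n : ℤ) {HT : Type} {LogLink : HT → HT → Type} {IsFull : ∀ {s t : HT}, LogLink s t → Prop}
      (lat : LGPGaussianLogThetaLattice LogLink IsFull)
      {Frd : Type} {IsoF : Frd → Frd → Type} {Ob : Frd → Type} {realify : Frd → Frd} {Strip : Type}
      {IsoS : Strip → Strip → Type} {Mv : ∀ v : (thetaIndexOfInitial T.D).V, v ∈ (thetaIndexOfInitial T.D).Vbad → Type}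
      [∀ v h, Monoid (Mv v h)]
      (sig : GlobalLGPFrobenioidSignature (thetaIndexOfInitial T.D).lstar (thetaIndexOfInitial T.D).V
        (· ∈ (thetaIndexOfInitial T.D).Vbad) Frd IsoF Ob realify Strip IsoS Mv)
      (split : SplittingMonoids Mv) {ObΔ : Type} {N : ∀ v : (thetaIndexOfInitial T.D).V, v ∈ (thetaIndexOfInitial T.D).Vbad → Type}
      [∀ v h, Monoid (N v h)] (qData : QPilotData ObΔ N)
      (qK : ∀ v : (thetaIndexOfInitial T.D).V, v ∈ (thetaIndexOfInitial T.D).Vbad →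
        Set ((logShellsOfInitialDH T.D (analyticLogvVal T.K)).StarPacket v)),
      ¬ Cor312Vol.PilotKummerCompatHull
        (LatticeSituation.ofShells (logShellsOfInitialDH T.D (analyticLogvVal T.K)) M archPk archSub
          (summandPiecesPrM T.D (logvAnalyticVal_analyticLogvVal (K := T.K))).Adm (summandPiecesPrM T.D (logvAnalyticVal_analyticLogvVal (K := T.K))).logvol Ψ act Mmod region frobAdm frobLogvol
          frobΨ frobMmod unitImage ballImage thetaDiv)
        (settingPrVolSharpM T.D (logvAnalyticVal_analyticLogvVal (K := T.K)) (tOfIdeleData T.D (ideleDataOf T.D T.isVolumeInputOf))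
          (fun u x => tqM T.D (ratChar u) u (natCast_ratChar_mem u) (ideleDataOf T.D T.isVolumeInputOf) x) M archPk archSub Ψ act Mmod region n lat sig split qData
          (fun u x => tqM_ne_zero T.D (ratChar u) u (natCast_ratChar_mem u) (ideleDataOf T.D T.isVolumeInputOf) x)
          (GenuineM.finite_ratPlaces_under_S T.D).toFinset
          (fun u x hu => norm_tqM_eq_one_of_not_mem T.D (ratChar u) u (natCast_ratChar_mem u) (ideleDataOf T.D T.isVolumeInputOf) x
            fun hx => hu ((Set.Finite.mem_toFinset _).mpr ⟨x, hx⟩)))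
        (fun _ => Cor312.Setting.qRegion
          (settingPrVolSharpM T.D (logvAnalyticVal_analyticLogvVal (K := T.K)) (tOfIdeleData T.D (ideleDataOf T.D T.isVolumeInputOf))
          (fun u x => tqM T.D (ratChar u) u (natCast_ratChar_mem u) (ideleDataOf T.D T.isVolumeInputOf) x) M archPk archSub Ψ act Mmod region n lat sig split qData
          (fun u x => tqM_ne_zero T.D (ratChar u) u (natCast_ratChar_mem u) (ideleDataOf T.D T.isVolumeInputOf) x)
          (GenuineM.finite_ratPlaces_under_S T.D).toFinset
          (fun u x hu => norm_tqM_eq_one_of_not_mem T.D (ratChar u) u (natCast_ratChar_mem u) (ideleDataOf T.D T.isVolumeInputOf) x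
            fun hx => hu ((Set.Finite.mem_toFinset _).mpr ⟨x, hx⟩)))) qK := by
  rcases Nat.lt_or_ge l 68 with hlt0 | hge0
  · exact GenuineM.not_pilotKummerCompatHull_triple_of_linUniform_cert isABCTriple_frey188728275341281 T u 13 hu (by norm_num) (by norm_num)
      (by norm_num) hneP.symm 2 (by show 30 * l < 13 ^ 2 * (13 - 1); norm_num; omega) 10 (by norm_num) (dvd_mul_of_dvd_left (dvd_mul_of_dvd_left (by norm_num) _) _) hl (by omega) 9 (by omega)
      (by norm_num) (by norm_num) (by norm_num)
  exact GenuineM.not_pilotKummerCompatHull_triple_of_linUniform_cert isABCTriple_frey188728275341281 T u 13 hu (by norm_num) (by norm_num)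
      (by norm_num) hneP.symm 3 (by show 30 * l < 13 ^ 3 * (13 - 1); norm_num; omega) 10 (by norm_num) (dvd_mul_of_dvd_left (dvd_mul_of_dvd_left (by norm_num) _) _) hl (by omega) 19 (by omega)
      (by norm_num) (by norm_num) (by norm_num)

/-- **M LINE — R-W ROWS `pilotDataOfK:frey-83521-501636678168150854-501636678168234375:l` for EVERY prime `12 ≤ l ≤ 480` — REFUTED side at the M
setting, unconditionally, BY ONE BAND THEOREM** (M twin of `GenuineK.not_pilotKummerCompatHull_chosen_frey83521_band`; deciding place `u` over `p =
7`) (block F3 of the R-W numerics lead's WINDOW-TABLE: 72 tabulated Szpiro-bad admissible `l` of this triple, `17 ≤ l ≤ 397`): triple `17 ^ 4 + 2 * 7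
^ 12 * 29 ^ 3 * 743 = 3 ^ 9 * 5 ^ 6 * 13 ^ 5 * 23 * 191`; deciding prime `p = 7` (`7^12 ∣ abc`, `p ∤ 30`), bands `B = 3` for `l ≤ 68` (certificate `l₀
= 12`); `B = 4` for `l ≤ 480` (certificate `l₀ = 25`): at the label `j = l⋆ = (l−1)/2` the [LIN]-uniform test of p464182 holds throughout the band
(quadratic certificate `LinUniformBand.test_of_cert`), so the hull-level clause S_H FAILS at the summand-route M-level sharp setting of the OWN
read-off ideles (pinned reading) of every genuine Θ-volume datum over `(ratPoint (a/c), l)` for every choice of the free context binders and Kummer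
datum. NOT claimed: admissibility / Szpiro-badness / (P6) / non-emptiness. [cite: Mochizuki2012, IUTchIII Cor. 3.12 Step (xi-f) p. 184; IUTchIV Prop.
1.2 p. 10] [claim: Mochizuki2012, status: disputed] -/
theorem GenuineM.not_pilotKummerCompatHull_frey83521_p7_band {l : ℕ} (hl : l.Prime) (hlo : 12 ≤ l) (hhi : l ≤ 480)
    (T : Cor22.ThetaVolumeDatumAt (ratPoint (((17 ^ 4 : ℕ) : ℚ) / (3 ^ 9 * 5 ^ 6 * 13 ^ 5 * 23 * 191 : ℕ))) l) (u : FinitePlace ℚ) (hu : ratChar u = 7) :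
    letI := T.instFieldF; letI := T.instNumberFieldF; letI := T.instAlgebraF; letI := T.instFieldK
    letI := T.instNumberFieldK; letI := T.instAlgebraK; letI := T.instFieldFbar; letI := T.instAlgebraFbar
    letI := T.instAlgebraKFbar; letI := T.instIsElliptic
    ∀ (M : Type) [Field M] [NumberField M]
      (archPk : ∀ (j : (thetaIndexOfInitial T.D).Label) (vQ : (thetaIndexOfInitial T.D).VQ),
        Set ((logShellsOfInitialDH T.D (analyticLogvVal T.K)).Packet j vQ))
      (archSub : ∀ (j : (thetaIndexOfInitial T.D).Label) (v : (thetaIndexOfInitial T.D).V),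
        Set ((logShellsOfInitialDH T.D (analyticLogvVal T.K)).Packet j ((thetaIndexOfInitial T.D).over v)))
      (Ψ : ℤ → ∀ v : (thetaIndexOfInitial T.D).V, v ∈ (thetaIndexOfInitial T.D).Vbad →
        Set ((logShellsOfInitialDH T.D (analyticLogvVal T.K)).StarPacket v))
      (act : ℤ → ∀ v : (thetaIndexOfInitial T.D).V, v ∈ (thetaIndexOfInitial T.D).Vbad →
        (logShellsOfInitialDH T.D (analyticLogvVal T.K)).StarPacket v →
          Module.End ℚ ((logShellsOfInitialDH T.D (analyticLogvVal T.K)).StarPacket v))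
      (Mmod : ℤ → ∀ j : (thetaIndexOfInitial T.D).LabelStar, Set ((logShellsOfInitialDH T.D (analyticLogvVal T.K)).GlobalPacket j.1))
      (region : ℤ → ∀ j : (thetaIndexOfInitial T.D).LabelStar, FinDivisor M → ∀ vQ : (thetaIndexOfInitial T.D).VQ,
        Set ((logShellsOfInitialDH T.D (analyticLogvVal T.K)).Packet j.1 vQ))
      (frobAdm : ℤ → ℤ → ∀ (j : (thetaIndexOfInitial T.D).Label) (vQ : (thetaIndexOfInitial T.D).VQ),
        Set ((logShellsOfInitialDH T.D (analyticLogvVal T.K)).Packet j vQ) → Prop)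
      (frobLogvol : ℤ → ℤ → ∀ (j : (thetaIndexOfInitial T.D).Label) (vQ : (thetaIndexOfInitial T.D).VQ),
        Set ((logShellsOfInitialDH T.D (analyticLogvVal T.K)).Packet j vQ) → ℝ)
      (frobΨ : ℤ → ℤ → ∀ v : (thetaIndexOfInitial T.D).V, v ∈ (thetaIndexOfInitial T.D).Vbad →
        Set ((logShellsOfInitialDH T.D (analyticLogvVal T.K)).StarPacket v))
      (frobMmod : ℤ → ℤ → ∀ j : (thetaIndexOfInitial T.D).LabelStar, Set ((logShellsOfInitialDH T.D (analyticLogvVal T.K)).GlobalPacket j.1))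
      (unitImage : ℤ → ℤ → ℕ → ∀ (j : (thetaIndexOfInitial T.D).Label) (vQ : (thetaIndexOfInitial T.D).VQ),
        Set ((logShellsOfInitialDH T.D (analyticLogvVal T.K)).Packet j vQ))
      (ballImage : ℤ → ℤ → ∀ (j : (thetaIndexOfInitial T.D).Label) (vQ : (thetaIndexOfInitial T.D).VQ),
        Set ((logShellsOfInitialDH T.D (analyticLogvVal T.K)).Packet j vQ))
      (thetaDiv : ℤ → ℤ → LgpDivisor M (thetaIndexOfInitial T.D).lstar)
      (n : ℤ) {HT : Type} {LogLink : HT → HT → Type} {IsFull : ∀ {s t : HT}, LogLink s t → Prop}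
      (lat : LGPGaussianLogThetaLattice LogLink IsFull)
      {Frd : Type} {IsoF : Frd → Frd → Type} {Ob : Frd → Type} {realify : Frd → Frd} {Strip : Type}
      {IsoS : Strip → Strip → Type} {Mv : ∀ v : (thetaIndexOfInitial T.D).V, v ∈ (thetaIndexOfInitial T.D).Vbad → Type}
      [∀ v h, Monoid (Mv v h)]
      (sig : GlobalLGPFrobenioidSignature (thetaIndexOfInitial T.D).lstar (thetaIndexOfInitial T.D).V
        (· ∈ (thetaIndexOfInitial T.D).Vbad) Frd IsoF Ob realify Strip IsoS Mv)
      (split : SplittingMonoids Mv) {ObΔ : Type} {N : ∀ v : (thetaIndexOfInitial T.D).V, v ∈ (thetaIndexOfInitial T.D).Vbad → Type}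
      [∀ v h, Monoid (N v h)] (qData : QPilotData ObΔ N)
      (qK : ∀ v : (thetaIndexOfInitial T.D).V, v ∈ (thetaIndexOfInitial T.D).Vbad →
        Set ((logShellsOfInitialDH T.D (analyticLogvVal T.K)).StarPacket v)),
      ¬ Cor312Vol.PilotKummerCompatHull
        (LatticeSituation.ofShells (logShellsOfInitialDH T.D (analyticLogvVal T.K)) M archPk archSub
          (summandPiecesPrM T.D (logvAnalyticVal_analyticLogvVal (K := T.K))).Adm (summandPiecesPrM T.D (logvAnalyticVal_analyticLogvVal (K := T.K))).logvol Ψ act Mmod region frobAdm frobLogvol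
          frobΨ frobMmod unitImage ballImage thetaDiv)
        (settingPrVolSharpM T.D (logvAnalyticVal_analyticLogvVal (K := T.K)) (tOfIdeleData T.D (ideleDataOf T.D T.isVolumeInputOf))
          (fun u x => tqM T.D (ratChar u) u (natCast_ratChar_mem u) (ideleDataOf T.D T.isVolumeInputOf) x) M archPk archSub Ψ act Mmod region n lat sig split qData
          (fun u x => tqM_ne_zero T.D (ratChar u) u (natCast_ratChar_mem u) (ideleDataOf T.D T.isVolumeInputOf) x)
          (GenuineM.finite_ratPlaces_under_S T.D).toFinset
          (fun u x hu => norm_tqM_eq_one_of_not_mem T.D (ratChar u) u (natCast_ratChar_mem u) (ideleDataOf T.D T.isVolumeInputOf) x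
            fun hx => hu ((Set.Finite.mem_toFinset _).mpr ⟨x, hx⟩)))
        (fun _ => Cor312.Setting.qRegion
          (settingPrVolSharpM T.D (logvAnalyticVal_analyticLogvVal (K := T.K)) (tOfIdeleData T.D (ideleDataOf T.D T.isVolumeInputOf))
          (fun u x => tqM T.D (ratChar u) u (natCast_ratChar_mem u) (ideleDataOf T.D T.isVolumeInputOf) x) M archPk archSub Ψ act Mmod region n lat sig split qData
          (fun u x => tqM_ne_zero T.D (ratChar u) u (natCast_ratChar_mem u) (ideleDataOf T.D T.isVolumeInputOf) x)
          (GenuineM.finite_ratPlaces_under_S T.D).toFinset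
          (fun u x hu => norm_tqM_eq_one_of_not_mem T.D (ratChar u) u (natCast_ratChar_mem u) (ideleDataOf T.D T.isVolumeInputOf) x
            fun hx => hu ((Set.Finite.mem_toFinset _).mpr ⟨x, hx⟩)))) qK := by
  have hneP : l ≠ 7 := by omega
  rcases Nat.lt_or_ge l 69 with hlt0 | hge0
  · exact GenuineM.not_pilotKummerCompatHull_triple_of_linUniform_cert isABCTriple_frey83521 T u 7 hu (by norm_num) (by norm_num)
      (by norm_num) hneP.symm 3 (by show 30 * l < 7 ^ 3 * (7 - 1); norm_num; omega) 12 (by norm_num) (dvd_mul_of_dvd_left (dvd_mul_of_dvd_right (by norm_num) _) _) hl (by omega) 12 (by omega)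
      (by norm_num) (by norm_num) (by norm_num)
  exact GenuineM.not_pilotKummerCompatHull_triple_of_linUniform_cert isABCTriple_frey83521 T u 7 hu (by norm_num) (by norm_num)
      (by norm_num) hneP.symm 4 (by show 30 * l < 7 ^ 4 * (7 - 1); norm_num; omega) 12 (by norm_num) (dvd_mul_of_dvd_left (dvd_mul_of_dvd_right (by norm_num) _) _) hl (by omega) 25 (by omega)
      (by norm_num) (by norm_num) (by norm_num)

/-- **M LINE — R-W ROWS `pilotDataOfK:frey-31117999167337103924704-75929189120022207165685625-75960307119189544269610329:l` for EVERY prime `6 ≤ l ≤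
3361` with `l ≠ 7` — REFUTED side at the M setting, unconditionally, BY ONE BAND THEOREM** (M twin of
`GenuineK.not_pilotKummerCompatHull_chosen_frey31117999167337103924704_band`; deciding place `u` over `p = 7`) (block F3 of the R-W numerics lead's
WINDOW-TABLE: 73 tabulated Szpiro-bad admissible `l` of this triple, `13 ≤ l ≤ 397`): triple `2 ^ 5 * 67 ^ 8 * 107 * 22381 + 5 ^ 4 * 53 ^ 6 * 353 ^ 5
= 3 ^ 22 * 7 ^ 14 * 43 * 83`; deciding prime `p = 7` (`7^14 ∣ abc`, `p ∤ 30`), bands `B = 2` for `l ≤ 9` (certificate `l₀ = 6`); `B = 3` for `l ≤ 68`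
(certificate `l₀ = 9`); `B = 4` for `l ≤ 480` (certificate `l₀ = 13`); `B = 5` for `l ≤ 3361` (certificate `l₀ = 29`); `l = 7` excluded on the M line
(one place `u` over `p`; the K twin decides it by `p' = 67`): at the label `j = l⋆ = (l−1)/2` the [LIN]-uniform test of p464182 holds throughout the
band (quadratic certificate `LinUniformBand.test_of_cert`), so the hull-level clause S_H FAILS at the summand-route M-level sharp setting of the OWN
read-off ideles (pinned reading) of every genuine Θ-volume datum over `(ratPoint (a/c), l)` for every choice of the free context binders and Kummer
datum. NOT claimed: admissibility / Szpiro-badness / (P6) / non-emptiness. [cite: Mochizuki2012, IUTchIII Cor. 3.12 Step (xi-f) p. 184; IUTchIV Prop.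
1.2 p. 10] [claim: Mochizuki2012, status: disputed] -/
theorem GenuineM.not_pilotKummerCompatHull_frey31117999167337103924704_p7_band {l : ℕ} (hl : l.Prime) (hlo : 6 ≤ l) (hhi : l ≤ 3361) (hneP : l ≠ 7)
    (T : Cor22.ThetaVolumeDatumAt (ratPoint (((2 ^ 5 * 67 ^ 8 * 107 * 22381 : ℕ) : ℚ) / (3 ^ 22 * 7 ^ 14 * 43 * 83 : ℕ))) l) (u : FinitePlace ℚ) (hu : ratChar u = 7) :
    letI := T.instFieldF; letI := T.instNumberFieldF; letI := T.instAlgebraF; letI := T.instFieldK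
    letI := T.instNumberFieldK; letI := T.instAlgebraK; letI := T.instFieldFbar; letI := T.instAlgebraFbar
    letI := T.instAlgebraKFbar; letI := T.instIsElliptic
    ∀ (M : Type) [Field M] [NumberField M]
      (archPk : ∀ (j : (thetaIndexOfInitial T.D).Label) (vQ : (thetaIndexOfInitial T.D).VQ),
        Set ((logShellsOfInitialDH T.D (analyticLogvVal T.K)).Packet j vQ))
      (archSub : ∀ (j : (thetaIndexOfInitial T.D).Label) (v : (thetaIndexOfInitial T.D).V),
        Set ((logShellsOfInitialDH T.D (analyticLogvVal T.K)).Packet j ((thetaIndexOfInitial T.D).over v)))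
      (Ψ : ℤ → ∀ v : (thetaIndexOfInitial T.D).V, v ∈ (thetaIndexOfInitial T.D).Vbad →
        Set ((logShellsOfInitialDH T.D (analyticLogvVal T.K)).StarPacket v))
      (act : ℤ → ∀ v : (thetaIndexOfInitial T.D).V, v ∈ (thetaIndexOfInitial T.D).Vbad →
        (logShellsOfInitialDH T.D (analyticLogvVal T.K)).StarPacket v →
          Module.End ℚ ((logShellsOfInitialDH T.D (analyticLogvVal T.K)).StarPacket v))
      (Mmod : ℤ → ∀ j : (thetaIndexOfInitial T.D).LabelStar, Set ((logShellsOfInitialDH T.D (analyticLogvVal T.K)).GlobalPacket j.1))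
      (region : ℤ → ∀ j : (thetaIndexOfInitial T.D).LabelStar, FinDivisor M → ∀ vQ : (thetaIndexOfInitial T.D).VQ,
        Set ((logShellsOfInitialDH T.D (analyticLogvVal T.K)).Packet j.1 vQ))
      (frobAdm : ℤ → ℤ → ∀ (j : (thetaIndexOfInitial T.D).Label) (vQ : (thetaIndexOfInitial T.D).VQ),
        Set ((logShellsOfInitialDH T.D (analyticLogvVal T.K)).Packet j vQ) → Prop)
      (frobLogvol : ℤ → ℤ → ∀ (j : (thetaIndexOfInitial T.D).Label) (vQ : (thetaIndexOfInitial T.D).VQ),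
        Set ((logShellsOfInitialDH T.D (analyticLogvVal T.K)).Packet j vQ) → ℝ)
      (frobΨ : ℤ → ℤ → ∀ v : (thetaIndexOfInitial T.D).V, v ∈ (thetaIndexOfInitial T.D).Vbad →
        Set ((logShellsOfInitialDH T.D (analyticLogvVal T.K)).StarPacket v))
      (frobMmod : ℤ → ℤ → ∀ j : (thetaIndexOfInitial T.D).LabelStar, Set ((logShellsOfInitialDH T.D (analyticLogvVal T.K)).GlobalPacket j.1))
      (unitImage : ℤ → ℤ → ℕ → ∀ (j : (thetaIndexOfInitial T.D).Label) (vQ : (thetaIndexOfInitial T.D).VQ),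
        Set ((logShellsOfInitialDH T.D (analyticLogvVal T.K)).Packet j vQ))
      (ballImage : ℤ → ℤ → ∀ (j : (thetaIndexOfInitial T.D).Label) (vQ : (thetaIndexOfInitial T.D).VQ),
        Set ((logShellsOfInitialDH T.D (analyticLogvVal T.K)).Packet j vQ))
      (thetaDiv : ℤ → ℤ → LgpDivisor M (thetaIndexOfInitial T.D).lstar)
      (n : ℤ) {HT : Type} {LogLink : HT → HT → Type} {IsFull : ∀ {s t : HT}, LogLink s t → Prop}
      (lat : LGPGaussianLogThetaLattice LogLink IsFull)
      {Frd : Type} {IsoF : Frd → Frd → Type} {Ob : Frd → Type} {realify : Frd → Frd} {Strip : Type}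
      {IsoS : Strip → Strip → Type} {Mv : ∀ v : (thetaIndexOfInitial T.D).V, v ∈ (thetaIndexOfInitial T.D).Vbad → Type}
      [∀ v h, Monoid (Mv v h)]
      (sig : GlobalLGPFrobenioidSignature (thetaIndexOfInitial T.D).lstar (thetaIndexOfInitial T.D).V
        (· ∈ (thetaIndexOfInitial T.D).Vbad) Frd IsoF Ob realify Strip IsoS Mv)
      (split : SplittingMonoids Mv) {ObΔ : Type} {N : ∀ v : (thetaIndexOfInitial T.D).V, v ∈ (thetaIndexOfInitial T.D).Vbad → Type}
      [∀ v h, Monoid (N v h)] (qData : QPilotData ObΔ N)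
      (qK : ∀ v : (thetaIndexOfInitial T.D).V, v ∈ (thetaIndexOfInitial T.D).Vbad →
        Set ((logShellsOfInitialDH T.D (analyticLogvVal T.K)).StarPacket v)),
      ¬ Cor312Vol.PilotKummerCompatHull
        (LatticeSituation.ofShells (logShellsOfInitialDH T.D (analyticLogvVal T.K)) M archPk archSub
          (summandPiecesPrM T.D (logvAnalyticVal_analyticLogvVal (K := T.K))).Adm (summandPiecesPrM T.D (logvAnalyticVal_analyticLogvVal (K := T.K))).logvol Ψ act Mmod region frobAdm frobLogvol
          frobΨ frobMmod unitImage ballImage thetaDiv)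
        (settingPrVolSharpM T.D (logvAnalyticVal_analyticLogvVal (K := T.K)) (tOfIdeleData T.D (ideleDataOf T.D T.isVolumeInputOf))
          (fun u x => tqM T.D (ratChar u) u (natCast_ratChar_mem u) (ideleDataOf T.D T.isVolumeInputOf) x) M archPk archSub Ψ act Mmod region n lat sig split qData
          (fun u x => tqM_ne_zero T.D (ratChar u) u (natCast_ratChar_mem u) (ideleDataOf T.D T.isVolumeInputOf) x)
          (GenuineM.finite_ratPlaces_under_S T.D).toFinset
          (fun u x hu => norm_tqM_eq_one_of_not_mem T.D (ratChar u) u (natCast_ratChar_mem u) (ideleDataOf T.D T.isVolumeInputOf) x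
            fun hx => hu ((Set.Finite.mem_toFinset _).mpr ⟨x, hx⟩)))
        (fun _ => Cor312.Setting.qRegion
          (settingPrVolSharpM T.D (logvAnalyticVal_analyticLogvVal (K := T.K)) (tOfIdeleData T.D (ideleDataOf T.D T.isVolumeInputOf))
          (fun u x => tqM T.D (ratChar u) u (natCast_ratChar_mem u) (ideleDataOf T.D T.isVolumeInputOf) x) M archPk archSub Ψ act Mmod region n lat sig split qData
          (fun u x => tqM_ne_zero T.D (ratChar u) u (natCast_ratChar_mem u) (ideleDataOf T.D T.isVolumeInputOf) x)
          (GenuineM.finite_ratPlaces_under_S T.D).toFinset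
          (fun u x hu => norm_tqM_eq_one_of_not_mem T.D (ratChar u) u (natCast_ratChar_mem u) (ideleDataOf T.D T.isVolumeInputOf) x
            fun hx => hu ((Set.Finite.mem_toFinset _).mpr ⟨x, hx⟩)))) qK := by
  rcases Nat.lt_or_ge l 10 with hlt0 | hge0
  · exact GenuineM.not_pilotKummerCompatHull_triple_of_linUniform_cert isABCTriple_frey31117999167337103924704 T u 7 hu (by norm_num) (by norm_num)
      (by norm_num) hneP.symm 2 (by show 30 * l < 7 ^ 2 * (7 - 1); norm_num; omega) 14 (by norm_num) (dvd_mul_of_dvd_right (by norm_num) _) hl (by omega) 6 (by omega)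
      (by norm_num) (by norm_num) (by norm_num)
  rcases Nat.lt_or_ge l 69 with hlt1 | hge1
  · exact GenuineM.not_pilotKummerCompatHull_triple_of_linUniform_cert isABCTriple_frey31117999167337103924704 T u 7 hu (by norm_num) (by norm_num)
      (by norm_num) hneP.symm 3 (by show 30 * l < 7 ^ 3 * (7 - 1); norm_num; omega) 14 (by norm_num) (dvd_mul_of_dvd_right (by norm_num) _) hl (by omega) 9 (by omega)
      (by norm_num) (by norm_num) (by norm_num)
  rcases Nat.lt_or_ge l 481 with hlt2 | hge2
  · exact GenuineM.not_pilotKummerCompatHull_triple_of_linUniform_cert isABCTriple_frey31117999167337103924704 T u 7 hu (by norm_num) (by norm_num)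
      (by norm_num) hneP.symm 4 (by show 30 * l < 7 ^ 4 * (7 - 1); norm_num; omega) 14 (by norm_num) (dvd_mul_of_dvd_right (by norm_num) _) hl (by omega) 13 (by omega)
      (by norm_num) (by norm_num) (by norm_num)
  exact GenuineM.not_pilotKummerCompatHull_triple_of_linUniform_cert isABCTriple_frey31117999167337103924704 T u 7 hu (by norm_num) (by norm_num)
      (by norm_num) hneP.symm 5 (by show 30 * l < 7 ^ 5 * (7 - 1); norm_num; omega) 14 (by norm_num) (dvd_mul_of_dvd_right (by norm_num) _) hl (by omega) 29 (by omega)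
      (by norm_num) (by norm_num) (by norm_num)

/-- **M LINE — R-W ROWS `pilotDataOfK:frey-3005846374259060721-4926054421161533193359375-4926057427007907452420096:l` for EVERY prime `6 ≤ l ≤ 22763`
with `l ≠ 29` — REFUTED side at the M setting, unconditionally, BY ONE BAND THEOREM** (M twin of
`GenuineK.not_pilotKummerCompatHull_chosen_frey3005846374259060721_band`; deciding place `u` over `p = 29`) (block F3 of the R-W numerics lead's
WINDOW-TABLE: 72 tabulated Szpiro-bad admissible `l` of this triple, `13 ≤ l ≤ 397`): triple `3 ^ 22 * 9787 ^ 2 + 5 ^ 10 * 11 * 29 ^ 10 * 109 = 2 ^ 37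
* 89 ^ 3 * 167 ^ 2 * 1823`; deciding prime `p = 29` (`29^10 ∣ abc`, `p ∤ 30`), bands `B = 1` for `l ≤ 27` (certificate `l₀ = 6`); `B = 2` for `l ≤
784` (certificate `l₀ = 9`); `B = 3` for `l ≤ 22763` (certificate `l₀ = 18`); `l = 29` excluded (`p = l` is outside the decider): at the label `j = l⋆
= (l−1)/2` the [LIN]-uniform test of p464182 holds throughout the band (quadratic certificate `LinUniformBand.test_of_cert`), so the hull-level clause
S_H FAILS at the summand-route M-level sharp setting of the OWN read-off ideles (pinned reading) of every genuine Θ-volume datum over `(ratPoint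
(a/c), l)` for every choice of the free context binders and Kummer datum. NOT claimed: admissibility / Szpiro-badness / (P6) / non-emptiness. [cite:
Mochizuki2012, IUTchIII Cor. 3.12 Step (xi-f) p. 184; IUTchIV Prop. 1.2 p. 10] [claim: Mochizuki2012, status: disputed] -/
theorem GenuineM.not_pilotKummerCompatHull_frey3005846374259060721_p29_band {l : ℕ} (hl : l.Prime) (hlo : 6 ≤ l) (hhi : l ≤ 22763) (hneP : l ≠ 29)
    (T : Cor22.ThetaVolumeDatumAt (ratPoint (((3 ^ 22 * 9787 ^ 2 : ℕ) : ℚ) / (2 ^ 37 * 89 ^ 3 * 167 ^ 2 * 1823 : ℕ))) l) (u : FinitePlace ℚ) (hu : ratChar u = 29) :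
    letI := T.instFieldF; letI := T.instNumberFieldF; letI := T.instAlgebraF; letI := T.instFieldK
    letI := T.instNumberFieldK; letI := T.instAlgebraK; letI := T.instFieldFbar; letI := T.instAlgebraFbar
    letI := T.instAlgebraKFbar; letI := T.instIsElliptic
    ∀ (M : Type) [Field M] [NumberField M]
      (archPk : ∀ (j : (thetaIndexOfInitial T.D).Label) (vQ : (thetaIndexOfInitial T.D).VQ),
        Set ((logShellsOfInitialDH T.D (analyticLogvVal T.K)).Packet j vQ))
      (archSub : ∀ (j : (thetaIndexOfInitial T.D).Label) (v : (thetaIndexOfInitial T.D).V),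
        Set ((logShellsOfInitialDH T.D (analyticLogvVal T.K)).Packet j ((thetaIndexOfInitial T.D).over v)))
      (Ψ : ℤ → ∀ v : (thetaIndexOfInitial T.D).V, v ∈ (thetaIndexOfInitial T.D).Vbad →
        Set ((logShellsOfInitialDH T.D (analyticLogvVal T.K)).StarPacket v))
      (act : ℤ → ∀ v : (thetaIndexOfInitial T.D).V, v ∈ (thetaIndexOfInitial T.D).Vbad →
        (logShellsOfInitialDH T.D (analyticLogvVal T.K)).StarPacket v →
          Module.End ℚ ((logShellsOfInitialDH T.D (analyticLogvVal T.K)).StarPacket v))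
      (Mmod : ℤ → ∀ j : (thetaIndexOfInitial T.D).LabelStar, Set ((logShellsOfInitialDH T.D (analyticLogvVal T.K)).GlobalPacket j.1))
      (region : ℤ → ∀ j : (thetaIndexOfInitial T.D).LabelStar, FinDivisor M → ∀ vQ : (thetaIndexOfInitial T.D).VQ,
        Set ((logShellsOfInitialDH T.D (analyticLogvVal T.K)).Packet j.1 vQ))
      (frobAdm : ℤ → ℤ → ∀ (j : (thetaIndexOfInitial T.D).Label) (vQ : (thetaIndexOfInitial T.D).VQ),
        Set ((logShellsOfInitialDH T.D (analyticLogvVal T.K)).Packet j vQ) → Prop)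
      (frobLogvol : ℤ → ℤ → ∀ (j : (thetaIndexOfInitial T.D).Label) (vQ : (thetaIndexOfInitial T.D).VQ),
        Set ((logShellsOfInitialDH T.D (analyticLogvVal T.K)).Packet j vQ) → ℝ)
      (frobΨ : ℤ → ℤ → ∀ v : (thetaIndexOfInitial T.D).V, v ∈ (thetaIndexOfInitial T.D).Vbad →
        Set ((logShellsOfInitialDH T.D (analyticLogvVal T.K)).StarPacket v))
      (frobMmod : ℤ → ℤ → ∀ j : (thetaIndexOfInitial T.D).LabelStar, Set ((logShellsOfInitialDH T.D (analyticLogvVal T.K)).GlobalPacket j.1))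
      (unitImage : ℤ → ℤ → ℕ → ∀ (j : (thetaIndexOfInitial T.D).Label) (vQ : (thetaIndexOfInitial T.D).VQ),
        Set ((logShellsOfInitialDH T.D (analyticLogvVal T.K)).Packet j vQ))
      (ballImage : ℤ → ℤ → ∀ (j : (thetaIndexOfInitial T.D).Label) (vQ : (thetaIndexOfInitial T.D).VQ),
        Set ((logShellsOfInitialDH T.D (analyticLogvVal T.K)).Packet j vQ))
      (thetaDiv : ℤ → ℤ → LgpDivisor M (thetaIndexOfInitial T.D).lstar)
      (n : ℤ) {HT : Type} {LogLink : HT → HT → Type} {IsFull : ∀ {s t : HT}, LogLink s t → Prop}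
      (lat : LGPGaussianLogThetaLattice LogLink IsFull)
      {Frd : Type} {IsoF : Frd → Frd → Type} {Ob : Frd → Type} {realify : Frd → Frd} {Strip : Type}
      {IsoS : Strip → Strip → Type} {Mv : ∀ v : (thetaIndexOfInitial T.D).V, v ∈ (thetaIndexOfInitial T.D).Vbad → Type}
      [∀ v h, Monoid (Mv v h)]
      (sig : GlobalLGPFrobenioidSignature (thetaIndexOfInitial T.D).lstar (thetaIndexOfInitial T.D).V
        (· ∈ (thetaIndexOfInitial T.D).Vbad) Frd IsoF Ob realify Strip IsoS Mv)
      (split : SplittingMonoids Mv) {ObΔ : Type} {N : ∀ v : (thetaIndexOfInitial T.D).V, v ∈ (thetaIndexOfInitial T.D).Vbad → Type}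
      [∀ v h, Monoid (N v h)] (qData : QPilotData ObΔ N)
      (qK : ∀ v : (thetaIndexOfInitial T.D).V, v ∈ (thetaIndexOfInitial T.D).Vbad →
        Set ((logShellsOfInitialDH T.D (analyticLogvVal T.K)).StarPacket v)),
      ¬ Cor312Vol.PilotKummerCompatHull
        (LatticeSituation.ofShells (logShellsOfInitialDH T.D (analyticLogvVal T.K)) M archPk archSub
          (summandPiecesPrM T.D (logvAnalyticVal_analyticLogvVal (K := T.K))).Adm (summandPiecesPrM T.D (logvAnalyticVal_analyticLogvVal (K := T.K))).logvol Ψ act Mmod region frobAdm frobLogvol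
          frobΨ frobMmod unitImage ballImage thetaDiv)
        (settingPrVolSharpM T.D (logvAnalyticVal_analyticLogvVal (K := T.K)) (tOfIdeleData T.D (ideleDataOf T.D T.isVolumeInputOf))
          (fun u x => tqM T.D (ratChar u) u (natCast_ratChar_mem u) (ideleDataOf T.D T.isVolumeInputOf) x) M archPk archSub Ψ act Mmod region n lat sig split qData
          (fun u x => tqM_ne_zero T.D (ratChar u) u (natCast_ratChar_mem u) (ideleDataOf T.D T.isVolumeInputOf) x)
          (GenuineM.finite_ratPlaces_under_S T.D).toFinset
          (fun u x hu => norm_tqM_eq_one_of_not_mem T.D (ratChar u) u (natCast_ratChar_mem u) (ideleDataOf T.D T.isVolumeInputOf) x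
            fun hx => hu ((Set.Finite.mem_toFinset _).mpr ⟨x, hx⟩)))
        (fun _ => Cor312.Setting.qRegion
          (settingPrVolSharpM T.D (logvAnalyticVal_analyticLogvVal (K := T.K)) (tOfIdeleData T.D (ideleDataOf T.D T.isVolumeInputOf))
          (fun u x => tqM T.D (ratChar u) u (natCast_ratChar_mem u) (ideleDataOf T.D T.isVolumeInputOf) x) M archPk archSub Ψ act Mmod region n lat sig split qData
          (fun u x => tqM_ne_zero T.D (ratChar u) u (natCast_ratChar_mem u) (ideleDataOf T.D T.isVolumeInputOf) x)
          (GenuineM.finite_ratPlaces_under_S T.D).toFinset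
          (fun u x hu => norm_tqM_eq_one_of_not_mem T.D (ratChar u) u (natCast_ratChar_mem u) (ideleDataOf T.D T.isVolumeInputOf) x
            fun hx => hu ((Set.Finite.mem_toFinset _).mpr ⟨x, hx⟩)))) qK := by
  rcases Nat.lt_or_ge l 28 with hlt0 | hge0
  · exact GenuineM.not_pilotKummerCompatHull_triple_of_linUniform_cert isABCTriple_frey3005846374259060721 T u 29 hu (by norm_num) (by norm_num)
      (by norm_num) hneP.symm 1 (by show 30 * l < 29 ^ 1 * (29 - 1); norm_num; omega) 10 (by norm_num) (dvd_mul_of_dvd_left (dvd_mul_of_dvd_right (by norm_num) _) _) hl (by omega) 6 (by omega)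
      (by norm_num) (by norm_num) (by norm_num)
  rcases Nat.lt_or_ge l 785 with hlt1 | hge1
  · exact GenuineM.not_pilotKummerCompatHull_triple_of_linUniform_cert isABCTriple_frey3005846374259060721 T u 29 hu (by norm_num) (by norm_num)
      (by norm_num) hneP.symm 2 (by show 30 * l < 29 ^ 2 * (29 - 1); norm_num; omega) 10 (by norm_num) (dvd_mul_of_dvd_left (dvd_mul_of_dvd_right (by norm_num) _) _) hl (by omega) 9 (by omega)
      (by norm_num) (by norm_num) (by norm_num)
  exact GenuineM.not_pilotKummerCompatHull_triple_of_linUniform_cert isABCTriple_frey3005846374259060721 T u 29 hu (by norm_num) (by norm_num)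
      (by norm_num) hneP.symm 3 (by show 30 * l < 29 ^ 3 * (29 - 1); norm_num; omega) 10 (by norm_num) (dvd_mul_of_dvd_left (dvd_mul_of_dvd_right (by norm_num) _) _) hl (by omega) 18 (by omega)
      (by norm_num) (by norm_num) (by norm_num)

end Summit.ABC.IUTFork.Conditional

end
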